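import Summits.Ventures.PackingBounds.ThreePointCert.K10d12LeafM1
import Summits.Ventures.PackingBounds.ThreePointCert.K10d12LeafM2
import Summits.Ventures.PackingBounds.ThreePointCert.K10d12LeafM3

/-!
# κ(10) ≤ 556: decoded intermediate polynomials of the split check of (ii')

Framing: lottery ticket; floor = certified bounds/negative ranges. Venture `PackingBounds` (cell
`pub-packcert`), three-point SDP family, kissing column. Integer data / kernel checks of a feasible point of the
Bachoc–Vallentin semidefinite program (n = 10, s = 1/2, three-point matrix degree 12, two-point (Gegenbauer) part to
degree L = 24, Bachoc–Vallentin multiplier set = cell mode sym2; exact rational certificate `sdp-n10-d12-s1-2-sym2-a24-hyb7-j143228.json`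
(sha256 ec3df9a54f2f215f2d69b4ef79b85f5fd23fd5faa12cd7f670a7d0c251362865) of the sdp seat's hybrid pipeline, verified by the cell's two exact verifiers), converted by
`cert2lean_g9.py` (lp gen 9; S = 64) into the units of the kernel checker `ThreePointCert.Check` + `CheckSym2` with the
record degree field set to L = 24 (the checker's degree enters only the unit `W = 2^d·d!` and the side conditions, so a
(d, L) certificate is a `Cert3` of degree L); Gram factor COLUMNS offset-encoded for the Kronecker-substitution validation
`ThreePointCert.CheckKS` (`sosCheckKS`: the claimed expansion and `Σ_k col_k²` compared at the point `(2^w, 2^{wD}, 2^{wD²})`); split check of (ii') `ThreePointCert.CheckSym2Split`.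
Emitter `emitlean_ks.py` (lp gen 10; coarse Gram factors `L′ ≈ L/2^k`, expansions `4^k • zᵀ(L′L′ᵀ)z` lifted by `SoundNN.boxNonneg_smul` as in lp gen 9's v3s). Generated file: plain lists of integers / monomials.
-/

namespace Summit.Ventures.PackingBounds.ThreePointCert.K10d12

open Literature.Geometry.DiscreteGeometry Literature.Geometry.DiscreteGeometry.PolyCert PolyCert.SPoly

/-- `M = target − E₀ − [g_qE₁ + (g_qE₁)(v,u,t) + (g_qE₁)(t,v,u)]` of the split check of (ii') (decoded term list). -/
def polyM : SPoly := ofFlat polyMf0 ++ ofFlat polyMf1 ++ ofFlat polyMf2 ++ ofFlat polyMf3 ++ ofFlat polyMf4 ++ ofFlat polyMf5 ++ ofFlat polyMf6 ++ ofFlat polyMf7 ++ ofFlat polyMf8 ++ ofFlat polyMf9 ++ ofFlat polyMf10 ++ ofFlat polyMf11 ++ ofFlat polyMf12 ++ ofFlat polyMf13 ++ ofFlat polyMf14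

/-- `M' = M − m₂E₂` of the split check of (ii') (decoded term list). -/
def polyMM : SPoly := ofFlat polyMMf0 ++ ofFlat polyMMf1 ++ ofFlat polyMMf2 ++ ofFlat polyMMf3 ++ ofFlat polyMMf4 ++ ofFlat polyMMf5 ++ ofFlat polyMMf6 ++ ofFlat polyMMf7 ++ ofFlat polyMMf8 ++ ofFlat polyMMf9 ++ ofFlat polyMMf10 ++ ofFlat polyMMf11 ++ ofFlat polyMMf12 ++ ofFlat polyMMf13 ++ ofFlat polyMMf14

end Summit.Ventures.PackingBounds.ThreePointCert.K10d12
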